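import Summits.QuantumFields.QCD.Theses.GapBuysCauchyRate
import Literature.MathematicalPhysics.QuantumFieldTheory.GaugeCovariantBlockMap
import HarnessLib

/-!
# Proof-side vocabulary of the line `registered` (birth, reshapes r1–r10) for crux `LadderCauchyRate`
(item stmt-QuantumFields-17307; route GapBuysCauchyRate, sub-problem QCD)

D-0016 `<RouteSlug>Defs` file (route-posited proof-side objects; nothing here is a named fact or a
claim): the vocabulary of the skeleton `Cruxes/LadderCauchyRate/Lines/birth.lean` and its ONE open
registered stub statement as a `Prop`-valued definition, so that the sorry-free transfer theorem
`SymanzikLadderBareStmt → LadderCauchyRate` (sibling file `GapBuysCauchyRateLadderCauchyRateOfBareLadder.lean`,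
assembled from the 16 landed stub files `GapBuysCauchyRateLadderCauchyRateStub*.lean`) and the eventual
proof of the stub are stated against ONE shared copy.

* `IsFar`, `farResponse` (+ `farResponse_nonneg`, `farResponse_le_of_forall_far`) — `δ`-far lattice
  points of a smeared insertion problem and the volume-summed truncated response of a local density
  there (`insertionCorr` of `GaugeCovariantBlockMap`);
* `HasCompactCovariantClustering 𝒞 m O d` — scale-covariant exponential clustering of dimension `d` of
  the truncated insertions of the density family `O k` into calibrated fields with COMPACTLY supported
  real test functions (the torus-seam-safe currency of reshape r3);
* `SymanzikDominationCS 𝒞 O t` — one-octave Symanzik domination of every calibrated increment by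
  `a_k + |t_k| +` raw far responses of compactly supported companion problems;
* `PinnedShift`, `PinnedZ`, `pinnedShiftOf` (+ `pinnedShift_eq`), `refB` — the pinned additive and
  multiplicative renormalisations of a calibrated family and the BARE reference two-point function
  `refB reg m f₀ s k` of the `z ≡ 1`, pinned-shift scheme on the reference pair `(Θf₀, f₀)`;
* `BareRefPositivity`, `BareSkewness` — eventual positivity of `Re refB` for `glue` and the
  flavour-changing mesons, and the scale-free skewness of the bare glue three-point function (the
  primitive lattice-side forms of the crux's clauses (iii), (iv));
* `SymanzikLadderBareStmt` — the open ∃-piece S1⁗ (r10): ONE witness regularisation carrying the two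
  scalings, summable spacings, the chiral clause (0), the matrix of `FullLatticeGap` (stmt-8928), bare
  reference positivity and skewness at one reference datum, and — for every pinned calibrated family —
  the one-octave rate block.  Its docstring says what it asserts and why it is crux-sized; the line's
  leads reported it for promotion (`promote-stub`), and the transfer theorem makes any proof of it close
  `LadderCauchyRate` in one line.

References: Symanzik 1983 / Lüscher–Weisz 1985 (effective-action remainders `a²O₆ + aO₅`);
Bałaban–O'Carroll–Schor 1989/1991 (block RG for Euclidean fermions); Glimm–Jaffe 1987 §18–19
(clustering ⇒ summable responses); Montvay–Münster 1994 §5.1 (Wilson quark masses, composite fields);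
Osterwalder–Seiler 1978 §2 (the lattice functional).  Everything here is a definition with a body or a
proved one-line API lemma.
-/

noncomputable section

namespace Summit.QuantumFields.QCD.Cruxes.LadderCauchyRate.Birth

open scoped BigOperators Topology Classical
open MeasureTheory Filter
open Literature.MathematicalPhysics.AQFT Literature.Probability.LatticeModels
  Literature.MathematicalPhysics.QuantumLattice Literature.MathematicalPhysics.QuantumFieldTheory
open Summit.QuantumFields.QCD.Theses.GapBuysCauchyRate

variable {Nf : ℕ}

/-- **Far points.** The lattice point `x` of the step with spacing `a` is `δ`-FAR from the real test
functions `f₁, …, fₙ` when its physical position `a·x ∈ ℝ⁴` is at Euclidean distance `≥ δ` from every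
topological support `tsupport fᵢ` (the separation convention of the tree's `IsBoundedInsertion`): the
off-diagonal regime, where no contact term is tested. -/
def IsFar {n : ℕ} (a δ : ℝ) (f : Fin n → SchwartzMap (EuclideanSpace ℝ (Fin 4)) ℝ)
    (x : Literature.Probability.LatticeModels.Site 4) : Prop :=
  ∀ i, ∀ y ∈ tsupport (f i : EuclideanSpace ℝ (Fin 4) → ℝ), δ ≤ dist (a • siteToE x) y

/-- **The far response** of the smeared `n`-point insertion problem `(σ, f)` at step `k` on the torus of
side `2S'+1` to the local density `O`: the volume sum, over the `δ`-far lattice points of the box, of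
the truncated insertion `‖⟨Φ_k^{σ₁}(f₁) ⋯ Φ_k^{σₙ}(fₙ) ; O(x)⟩_conn‖` (`insertionCorr`).  Before any
clustering it may be as large as `(#far points) × sup`, i.e. grow with the volume. -/
def farResponse (sch : QCDScheme Nf) (k S' n : ℕ) (σ : Fin n → QCDField Nf)
    (f : Fin n → SchwartzMap (EuclideanSpace ℝ (Fin 4)) ℝ) {R : ℕ} (O : QCDLatticeObservable Nf R)
    (δ : ℝ) : ℝ :=
  ∑ x ∈ (Literature.Probability.LatticeModels.box 4 S').filter (fun x => IsFar (sch.a k) δ f x),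
    ‖insertionCorr sch k S' n σ f O x‖

/-- Far responses are non-negative. -/
theorem farResponse_nonneg (sch : QCDScheme Nf) (k S' n : ℕ) (σ : Fin n → QCDField Nf)
    (f : Fin n → SchwartzMap (EuclideanSpace ℝ (Fin 4)) ℝ) {R : ℕ} (O : QCDLatticeObservable Nf R)
    (δ : ℝ) : 0 ≤ farResponse sch k S' n σ f O δ :=
  Finset.sum_nonneg fun _ _ => norm_nonneg _

/-- **`T`-form ⇒ `farResponse` bound.** A bound for the sum of `‖insertion‖` over every finite set of
`δ`-far points of the box bounds the far response (take `T` = the far points of the box). -/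
theorem farResponse_le_of_forall_far (sch : QCDScheme Nf) (k S' n : ℕ) (σ : Fin n → QCDField Nf)
    (f : Fin n → SchwartzMap (EuclideanSpace ℝ (Fin 4)) ℝ) {R : ℕ} (O : QCDLatticeObservable Nf R)
    (δ B : ℝ)
    (h : ∀ T : Finset (Literature.Probability.LatticeModels.Site 4),
      T ⊆ Literature.Probability.LatticeModels.box 4 S' →
      (∀ x ∈ T, ∀ i, ∀ y ∈ tsupport (f i : EuclideanSpace ℝ (Fin 4) → ℝ),
          δ ≤ dist (sch.a k • siteToE x) y) →
        ∑ x ∈ T, ‖insertionCorr sch k S' n σ f O x‖ ≤ B) :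
    farResponse sch k S' n σ f O δ ≤ B :=
  h _ (Finset.filter_subset _ _) fun _ hx => (Finset.mem_filter.1 hx).2

/-- **Scale-covariant clustering of dimension `d` on COMPACTLY SUPPORTED problems** (the restriction
to compact supports is essential: for Schwartz tails the bound is false through the periodic torus
seam — the `N_f = 0`, `β = 0` witness of the line's deleted stub S2): for every arity
`n ≥ 1`, species string, real test functions `fᵢ` WITH COMPACT SUPPORT carrying an off-diagonal
tensor, and every `δ > 0`: at `δ`-far points the truncated insertion of `O_k(x)` is bounded by the
scaling factor `a_k^d` times the exponential clustering weight `Σᵢ ∫ |fᵢ(y)| e^{−μ dist(a_k x, y)} dy`,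
with ONE rate `μ > 0` and ONE constant for all large `k`, all tori of side `≥ 2L_k+1` and all far
points.  Compact support puts the sampled support in `|x'|_∞ ≤ ρ_f/a_k ≪ L_k ≤ S'` eventually, so the
torus distance from any box point to it is at least `1/8` of the representative distance and the
`ℝ⁴`-weight is an honest minorant of torus clustering (rate `μ = m/8`). -/
def HasCompactCovariantClustering {reg : QCDRegularisation Nf} (𝒞 : CalibratedSpeciesFamily reg)
    (m : Fin Nf → ℝ) {R : ℕ} (O : ℕ → QCDLatticeObservable Nf R) (d : ℕ) : Prop :=
  ∀ n : ℕ, n ≠ 0 → ∀ (σ : Fin n → QCDField Nf) (f : Fin n → SchwartzMap (EuclideanSpace ℝ (Fin 4)) ℝ)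
    (F : SchwartzMap (Fin n → EuclideanSpace ℝ (Fin 4)) ℂ),
    IsTensorOf F (fun i => ofRealTest (f i)) → IsOffDiagonal F →
    (∀ i, HasCompactSupport (f i : EuclideanSpace ℝ (Fin 4) → ℝ)) →
      ∀ δ : ℝ, 0 < δ → ∃ μ : ℝ, 0 < μ ∧ ∃ C : ℝ, ∀ᶠ k in Filter.atTop, ∀ S' : ℕ, reg.L k ≤ S' →
        ∀ x ∈ Literature.Probability.LatticeModels.box 4 S', IsFar (reg.a k) δ f x →
          ‖insertionCorr (𝒞.scheme m) k S' n σ f (O k) x‖ ≤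
            C * reg.a k ^ d * ∑ i, ∫ y, |f i y| * Real.exp (-(μ * dist (reg.a k • siteToE x) y))

/-- **One-octave Symanzik domination with COMPACTLY SUPPORTED companions** (OneStepSymanzik's
deliverable in response form, repair (A′)).  For every positive mass tuple and every off-diagonal
insertion problem `(n, σ, f)` there are finitely many COMPANION off-diagonal problems
`(n'_l, σ'_l, f'_l)` at the same mass whose real test functions have compact support (the prover's
choice: bump versions of the problem, the calibration pairs `(Θf₀, f₀)`, lower-point bumps …), a
resolution `δ > 0` and `C₀` such that eventually in `k` the one-octave increment of the calibrated
`n`-point function along the scheme's own ladder is dominated by `a_k` (near field: contact terms,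
operator improvement, re-calibration, finite-volume and tail bookkeeping), a summable mass-independent
retuning residual `|t_k|`, and the RAW far responses of the companions to the remainder densities
`O_j k`: `‖S_(k+1) − S_k‖ ≤ C₀ (a_k + |t_k| + Σ_j Σ_l farResponse_{j,l}(k))`. -/
def SymanzikDominationCS {reg : QCDRegularisation Nf} (𝒞 : CalibratedSpeciesFamily reg) {J R : ℕ}
    (O : Fin J → ℕ → QCDLatticeObservable Nf R) (t : ℕ → ℝ) : Prop :=
  ∀ m : Fin Nf → ℝ, (∀ fl, 0 < m fl) → ∀ n : ℕ, n ≠ 0 → ∀ (σ : Fin n → QCDField Nf)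
    (f : Fin n → SchwartzMap (EuclideanSpace ℝ (Fin 4)) ℝ) (F : SchwartzMap (Fin n → EuclideanSpace ℝ (Fin 4)) ℂ),
    IsTensorOf F (fun i => ofRealTest (f i)) → IsOffDiagonal F →
      ∃ (L : ℕ) (n' : Fin L → ℕ) (σ' : (l : Fin L) → Fin (n' l) → QCDField Nf)
        (f' : (l : Fin L) → Fin (n' l) → SchwartzMap (EuclideanSpace ℝ (Fin 4)) ℝ),
        (∀ l, n' l ≠ 0 ∧ (∀ i, HasCompactSupport (f' l i : EuclideanSpace ℝ (Fin 4) → ℝ)) ∧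
          ∃ F' : SchwartzMap (Fin (n' l) → EuclideanSpace ℝ (Fin 4)) ℂ,
            IsTensorOf F' (fun i => ofRealTest (f' l i)) ∧ IsOffDiagonal F') ∧
        ∃ δ : ℝ, 0 < δ ∧ ∃ C₀ : ℝ, ∀ᶠ k in Filter.atTop,
          ‖qcdLatticeSchwinger (𝒞.scheme m) (k + 1) n σ f - qcdLatticeSchwinger (𝒞.scheme m) k n σ f‖ ≤
            C₀ * (reg.a k + |t k| +
              ∑ j, ∑ l, farResponse (𝒞.scheme m) k (reg.L k) (n' l) (σ' l) (f' l) (O j k) δ)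

/-- **Pinned additive counterterms**: `shift_s(m,k)` is the real part of the bare one-point torus
expectation of the species insertion at the origin, at the scheme's own coupling, bare masses and
torus (the honest value `⟨O_s(0)⟩`, real and site-independent by the one-point law; `0` on the junk
branch). -/
def PinnedShift (reg : QCDRegularisation Nf) (𝒞 : CalibratedSpeciesFamily reg) : Prop :=
  ∀ (m : Fin Nf → ℝ) (s : QCDField Nf) (k : ℕ),
    𝒞.shift m s k =
      (qcdTorusExpect (reg.β k) (2 * reg.L k + 1) (fun fl => (reg.scheme m 0 0).mq fl k)
        (fun U => insertion U s 0)).re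

/-- **Pinned multiplicative renormalisations**: with `C` the connected two-point function of the
`z ≡ 1` scheme (same counterterms) on the reference pair `(Θf₀, f₀)`, `z_s(m,k) = C^{-1/2}` when `C` is
a positive real (the proviso branch of `IsCalibratedAt`) and `z_s(m,k) = ζ_s(m,k)` otherwise. -/
def PinnedZ (reg : QCDRegularisation Nf) (ζ : (Fin Nf → ℝ) → QCDField Nf → ℕ → ℝ)
    (𝒞 : CalibratedSpeciesFamily reg) : Prop :=
  ∀ (m : Fin Nf → ℝ) (s : QCDField Nf) (k : ℕ),
    ((0 < ((reg.scheme m (fun _ _ => (1 : ℝ)) (𝒞.shift m)).connectedTwoPoint k s s (thetaTest 4 𝒞.f₀) 𝒞.f₀).re ∧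
        ((reg.scheme m (fun _ _ => (1 : ℝ)) (𝒞.shift m)).connectedTwoPoint k s s (thetaTest 4 𝒞.f₀) 𝒞.f₀).im = 0) →
      𝒞.z m s k =
        (Real.sqrt ((reg.scheme m (fun _ _ => (1 : ℝ)) (𝒞.shift m)).connectedTwoPoint k s s
          (thetaTest 4 𝒞.f₀) 𝒞.f₀).re)⁻¹) ∧
    (¬ (0 < ((reg.scheme m (fun _ _ => (1 : ℝ)) (𝒞.shift m)).connectedTwoPoint k s s (thetaTest 4 𝒞.f₀) 𝒞.f₀).re ∧
        ((reg.scheme m (fun _ _ => (1 : ℝ)) (𝒞.shift m)).connectedTwoPoint k s s (thetaTest 4 𝒞.f₀) 𝒞.f₀).im = 0) →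
      𝒞.z m s k = ζ m s k)

/-- **The pinned shift as an explicit function of the regularisation**: `shift_s(m,k) =
Re ⟨O_s(0)⟩` at `β_k`, the bare masses `m_f(k)` of `reg` at `m`, on the torus of side `2L_k+1`.
`PinnedShift reg 𝒞` says exactly `𝒞.shift = pinnedShiftOf reg` (`pinnedShift_eq`). -/
def pinnedShiftOf (reg : QCDRegularisation Nf) (m : Fin Nf → ℝ) : QCDField Nf → ℕ → ℝ :=
  fun s k => (qcdTorusExpect (reg.β k) (2 * reg.L k + 1) (fun fl => (reg.scheme m 0 0).mq fl k)
    (fun U => insertion U s 0)).re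

/-- `PinnedShift` unfolded as an equality of functions. -/
theorem pinnedShift_eq {reg : QCDRegularisation Nf} {𝒞 : CalibratedSpeciesFamily reg}
    (h : PinnedShift reg 𝒞) (m : Fin Nf → ℝ) : 𝒞.shift m = pinnedShiftOf reg m :=
  funext fun s => funext fun k => h m s k

/-- **The bare reference two-point function**: the connected two-point function of species `s`
on the reference pair `(Θf₀, f₀)` at step `k` for the `z ≡ 1`, pinned-shift scheme of `reg` at the
mass tuple `m` — a number determined by the honest lattice functional of `reg` alone. -/
def refB (reg : QCDRegularisation Nf) (m : Fin Nf → ℝ) (f₀ : SchwartzMap (EuclideanSpace ℝ (Fin 4)) ℝ)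
    (s : QCDField Nf) (k : ℕ) : ℂ :=
  (reg.scheme m (fun _ _ => (1 : ℝ)) (pinnedShiftOf reg m)).connectedTwoPoint k s s (thetaTest 4 f₀) f₀

/-- **Bare reference POSITIVITY at `m`** (the primitive form of the crux's clause (iii)): eventually
in `k` the bare reference two-point functions of `glue` and of every flavour-changing `pseudoRe f g`
have positive real part (reflection positivity of the Wilson-fermion transfer matrix + non-degeneracy +
`(−1)^F`-twist bookkeeping on the scheme's own torus — witness physics).  Their REALITY is a theorem for
every scheme (landed laws `stub_glueTwoPointReal` for `glue`, `stub_mesonTwoPointReal` for the mesons),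
and positivity + reality transfer to the calibration identities `twoPoint (𝒞.scheme m) = 1` of every
pinned family (landed law `stub_calibrationTransfer`). -/
def BareRefPositivity (reg : QCDRegularisation Nf) (m : Fin Nf → ℝ)
    (f₀ : SchwartzMap (EuclideanSpace ℝ (Fin 4)) ℝ) : Prop :=
  (∀ᶠ k in Filter.atTop, 0 < (refB reg m f₀ QCDField.glue k).re) ∧
  ∀ f g : Fin Nf, f ≠ g → ∀ᶠ k in Filter.atTop, 0 < (refB reg m f₀ (QCDField.pseudoRe f g) k).re

/-- **Bare glue skewness at `m`, 𝒞-FREE form** (r8, the primitive form of clause (iv) as a property of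
`reg` alone): real bumps `f, g, h` in the three time slabs and `ε > 0` with
`ε · (Re refB_glue(k))^{3/2} ≤ ‖S₃^{bare}(k; f, g, h)‖` eventually, `S₃^{bare}` the three-point glue
function of the `z ≡ 1`, pinned-shift scheme.  For a pinned family whose bare glue reference function
is eventually positive this is equivalent to the per-family form `ε ≤ z_glue(m,k)³ ‖S₃‖`
(`z_glue = (Re refB_glue)^{-1/2}` on the proviso branch of `PinnedZ`; landed law
`stub_skewnessTransfer`), which is the crux's `κ₃` clause (iv) for `𝒞.scheme m` (landed law
`stub_kappa3Transfer`: the subtracted one-point functions vanish). -/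
def BareSkewness (reg : QCDRegularisation Nf) (m : Fin Nf → ℝ)
    (f₀ : SchwartzMap (EuclideanSpace ℝ (Fin 4)) ℝ) : Prop :=
  ∃ f g h : SchwartzMap (EuclideanSpace ℝ (Fin 4)) ℝ,
    tsupport (f : EuclideanSpace ℝ (Fin 4) → ℝ) ⊆ {x | x 0 < 0} ∧
    tsupport (g : EuclideanSpace ℝ (Fin 4) → ℝ) ⊆ {x | 0 < x 0 ∧ x 0 < 1} ∧
    tsupport (h : EuclideanSpace ℝ (Fin 4) → ℝ) ⊆ {x | 1 < x 0} ∧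
    ∃ ε > (0 : ℝ), ∀ᶠ k in Filter.atTop,
      ε * Real.sqrt ((refB reg m f₀ QCDField.glue k).re) ^ 3 ≤
        ‖qcdLatticeSchwinger (reg.scheme m (fun _ _ => (1 : ℝ)) (pinnedShiftOf reg m)) k 3
          ![QCDField.glue, QCDField.glue, QCDField.glue] ![f, g, h]‖

/-- **The ∃-piece of the line (open registered stub S1⁗ of the skeleton, reshape r10; open-problem
strength, reported for promotion).**  For `N_f = 2, 3`: a mass-scaling, asymptotically scaling
regularisation `reg` with summable spacings, CHIRAL AT ZERO (the crux's clause (0) itself: the lattice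
gap of `reg.scheme m 0 0` closes as `m → 0⁺`; the intended mechanism, a light flavour-changing
pseudoscalar along the own tori, implies it by the landed law `stub_chiralOfLightSeq`),
critical bare masses eventually on the physical branch and a UNIFORM LATTICE GAP of `reg.scheme m 0 0`
at every positive mass tuple (the matrix of `FullLatticeGap`, stmt-8928), reference data `(τ₀, f₀)` at
which the BARE reference two-point functions of `glue` and of every flavour-changing `pseudoRe f g`
have eventually POSITIVE real part (`BareRefPositivity`; their reality is a theorem, W4/W7b) and the
bare glue three-point function is eventually skew in scale-free form (`BareSkewness`), positive
off-proviso values `ζ`, and — for EVERY calibrated family over `reg` with these data and pinned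
`shift`, `z` (one exists for every `reg`: landed law `stub_calibratedFamily`) — a summable retuning
residual `t`, finitely many
remainder-density families `O_j` of dimension `dim j ≥ 5` clustering scale-covariantly on compactly
supported problems, and one-octave Symanzik domination through compactly supported companions.  Route
children inside: (0) = ChiralTuning (stmt-17560); (i) ∧ (ii) = FullLatticeGap (stmt-8928); the UV
block = OneStepSymanzik (stmt-11540) × CalibratedClustering (stmt-11541); bare reference positivity /
skewness = the lattice-side inputs of the species witnesses (no item yet).  Why crux-sized: every
conjunct is open-problem strength (weak-coupling lattice `SU(3)` + Wilson-quark gap uniformly in `k`;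
gaplessness of the chiral limit; strict positivity of the `(−1)^F`-twisted periodic functional on the
reference pair as `ℓ_k → ∞`; a one-octave Bałaban–O'Carroll–Schor/Symanzik step with `k`-uniform
`O₆/O₅` insertion bounds — none in print, not even for `YM₄`), and they concern ONE existential
witness, so they cannot be filed as separate items without first NAMING the witness. -/
def SymanzikLadderBareStmt : Prop :=
  ∀ Nf : ℕ, Nf = 2 ∨ Nf = 3 → ∃ reg : QCDRegularisation Nf,
    reg.HasMassScaling ∧ (reg.scheme 0 0 0).HasAsymptoticScaling ∧ Summable reg.a ∧
    reg.IsChiralAtZero ∧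
    (∀ m : Fin Nf → ℝ, (∀ f, 0 < m f) →
      (∀ fl : Fin Nf, ∀ᶠ k in Filter.atTop, -1 < (reg.scheme m 0 0).mq fl k) ∧
      ∃ Δ > 0, (reg.scheme m 0 0).HasLatticeMassGap Δ) ∧
    ∃ τ₀ : ℝ, 0 < τ₀ ∧ ∃ f₀ : SchwartzMap (EuclideanSpace ℝ (Fin 4)) ℝ, f₀ ≠ 0 ∧
      tsupport (f₀ : EuclideanSpace ℝ (Fin 4) → ℝ) ⊆ timeSlab 4 (τ₀ / 2) τ₀ ∧
      (∀ m : Fin Nf → ℝ, (∀ f, 0 < m f) → BareRefPositivity reg m f₀ ∧ BareSkewness reg m f₀) ∧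
      ∃ ζ : (Fin Nf → ℝ) → QCDField Nf → ℕ → ℝ, (∀ m s k, 0 < ζ m s k) ∧
        ∀ 𝒞 : CalibratedSpeciesFamily reg, 𝒞.τ₀ = τ₀ → 𝒞.f₀ = f₀ →
          PinnedShift reg 𝒞 → PinnedZ reg ζ 𝒞 →
          ∃ t : ℕ → ℝ, Summable t ∧
            ∃ (J R : ℕ) (O : Fin J → ℕ → QCDLatticeObservable Nf R) (dim : Fin J → ℕ),
              (∀ j, 5 ≤ dim j) ∧
              (∀ j, ∀ m : Fin Nf → ℝ, (∀ f, 0 < m f) → HasCompactCovariantClustering 𝒞 m (O j) (dim j)) ∧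
              SymanzikDominationCS 𝒞 O t

end Summit.QuantumFields.QCD.Cruxes.LadderCauchyRate.Birth

end
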